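import Summits.NavierStokesRegularity.FluidComputer.PalasekTowerRegisterGlobalHeredity

/-!
# REGISTER v2.3′ over a general MARGIN, and the design class as a margin conjunct — the honest
# `∃ design, ∀ stage IN the design` shape of both cruxes, by name

Cell `ns-blowup`, seat `ns-blowup-ecbridge-1` (g4); companion of `PalasekTowerRegisterGlobal.lean`
(p411629: the items of record `EpisodeBaseG` / `EpisodeInductionG` — pinned, rigid, quiet schedules on
the wide-base rates, margin `Margins.routeG TowerRates.wide`), `PalasekTowerRegisterGlobalHeredity.lean`
(p415576: `HeredityAt k`), `PalasekTowerRegisterGlobalDesign.lean` (ecbridge-4, p418872: the LEVEL-0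
design class `HostClass`, `HostPreparationD` / `FirstEpisodeD`) and `PalasekTowerDepth.lean` (g2,
p406752: `BaseIn 𝒟` / `HereditaryIn 𝒟` over a class of SCHEDULES, Shape-E vocabulary). LABEL: E–C
typing (KERNEL vocabulary: the register's two open `Prop`s with the MARGIN as a parameter, transport,
assembly, closer; every implication proved). WHAT THIS IS NOT: not Navier–Stokes evidence — no
stage, design, tower or instance is constructed or claimed; the `@[conjecture]` definitions are never
asserted and are NOT route items (the items of record stay `EpisodeBaseG` / `EpisodeInductionG` /
`HeredityAtOne` / `HeredityFrom 2`, planner RULINGS STATUS l.1890 / l.2052).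

## Why (planner RULING l.1890 (1),(3): «`EpisodeBaseG` is ∃S ∃stage: its honest lossless split is by CONSTRUCTION STAGES OF A NAMED WITNESS CLASS, not by a ∀ over un-named hosts»; ecbridge-1 g4 memo EC-BRIDGE-v3 §2 «the ∀-exposure principle reads verbatim at every level»)

A registered stage is pinned only by finitely many READOUTS, so every heredity statement
«∀ schedule ∀ stage at level `k`, ∃ extension» — K2G, its first rung `HeredityAtOne`, the withdrawn
`FirstEpisode*` forms — asks the adversarial MINIMAL inhabitants of the readouts to produce the next
level by their own inertia. The shape a construction actually proves is `∃ D` (a NAMED design class,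
closed under one episode) `∧ ∀ stage IN D`. In the register's own architecture the design class is
simply ONE MORE MARGIN CONJUNCT: `Margins` is the registered extension slot of `Stage`
(`PalasekTowerEpisodes`: «a PARAMETER of the split; the cell registers one before filing»). So:

* §1 the v2.3′ pair over a general margin `m` — `EpisodeBaseGM m`, `EpisodeInductionGM m`,
  `HeredityAtGM m k` — with the items of record recovered at `m = Margins.routeG TowerRates.wide`
  DEFINITIONALLY (`…_routeG_iff`, `Iff.rfl`), the assembly (`Realisation.ofEpisodes` is margin-generic),
  `PalasekStep2` and the closer to Fefferman's (C) for EVERY margin;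
* §2 `Stage.mapMargin` (transport along a pointwise implication of margins) and the design conjunct
  `Margins.withDesign D m := D ∧ m`: the base over `withDesign D m` implies the base over `m`
  (drop `D`); the induction over `withDesign D m` is the unbundled «every registered stage IN `D`
  extends to one IN `D`» (`episodeInductionGM_withDesign_iff`) — neither weaker nor stronger than the
  induction over `m` in general (it assumes `D` of the stage and owes `D` of the extension), equal to
  it for the trivial class (`…_withDesign_top_iff`); with `m = routeG wide` every K48/K49 lever stays
  dead because the global anchor and rigidity remain conjuncts (`Stage.ofWithDesign`).

When a design `D` is named (ecbridge-4's `GoodHost` at level `0`; a level-`k` shape class later), the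
honest items are the ONE-LINERS `EpisodeBaseGM (withDesign D (routeG wide))` /
`EpisodeInductionGM (withDesign D (routeG wide))` (or its rung `HeredityAtGM … 1`), and this file's
closer takes them to (C) with W14 exactly as the route's `closes` does.

References: S. Palasek, arXiv:2605.13827 §3.3–§4 [cite: Palasek2026ElementaryModel, §4];
C. L. Fefferman, Clay problem description, (C) [cite: FeffermanClay2006, (C)]; T. Tao, Anal. PDE 6
(2013), Cor. 11.4 [cite: Tao2011, Cor. 11.4].
-/

noncomputable section

namespace Summit.NavierStokesRegularity.FluidComputer.PalasekTowerClayBridge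

open Set MeasureTheory Filter Topology Function
open scoped ENNReal ContDiff NNReal
open Literature.Analysis.FluidPDE

/-! ## §1 The v2.3′ pair over a general margin -/

/-- **K1G over the margin `m`** (open for any serious `m`; never asserted): a pinned (`Λ = 8`,
`θ = 6/5`), rigid, quiet schedule on the wide-base rates carries a stage at level `1` with margin `m`
at unit viscosity. `EpisodeBaseGM (Margins.routeG TowerRates.wide)` is `EpisodeBaseG`.
[cite: Palasek2026ElementaryModel, §4] -/
@[conjecture] def EpisodeBaseGM (m : Margins TowerRates.wide) : Prop :=
  ∃ S : Schedule TowerRates.wide, S.Pins 8 (6 / 5) ∧ S.Rigid ∧ S.Quiet ∧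
    Nonempty (Stage 1 TowerRates.wide S m 1)

/-- **K2G over the margin `m`** (open; never asserted): over pinned, rigid, quiet schedules on the
wide-base rates, every stage with margin `m` at level `k ≥ 1` extends to one with margin `m` at
level `k + 1`. `EpisodeInductionGM (Margins.routeG TowerRates.wide)` is `EpisodeInductionG`.
[cite: Palasek2026ElementaryModel, §4] -/
@[conjecture] def EpisodeInductionGM (m : Margins TowerRates.wide) : Prop :=
  ∀ S : Schedule TowerRates.wide, S.Pins 8 (6 / 5) → S.Rigid → S.Quiet → ∀ k : ℕ, 1 ≤ k →
    ∀ s : Stage 1 TowerRates.wide S m k, ∃ s' : Stage 1 TowerRates.wide S m (k + 1), s.Extends s'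

/-- **Heredity at level `k` over the margin `m`** (open; never asserted): the one hand-over
`k → k + 1` of `EpisodeInductionGM m`. `HeredityAtGM (Margins.routeG TowerRates.wide) k` is
`HeredityAt k`. [cite: Palasek2026ElementaryModel, §4] -/
@[conjecture] def HeredityAtGM (m : Margins TowerRates.wide) (k : ℕ) : Prop :=
  ∀ S : Schedule TowerRates.wide, S.Pins 8 (6 / 5) → S.Rigid → S.Quiet →
    ∀ s : Stage 1 TowerRates.wide S m k, ∃ s' : Stage 1 TowerRates.wide S m (k + 1), s.Extends s'

/-- The items of record are the case `m = routeG wide` (definitionally). [folklore] -/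
theorem episodeBaseGM_routeG_iff : EpisodeBaseGM (Margins.routeG TowerRates.wide) ↔ EpisodeBaseG :=
  Iff.rfl

/-- The items of record are the case `m = routeG wide` (definitionally). [folklore] -/
theorem episodeInductionGM_routeG_iff :
    EpisodeInductionGM (Margins.routeG TowerRates.wide) ↔ EpisodeInductionG := Iff.rfl

/-- Heredity over the route margin is p415576's `HeredityAt` (definitionally). [folklore] -/
theorem heredityAtGM_routeG_iff (k : ℕ) : HeredityAtGM (Margins.routeG TowerRates.wide) k ↔ HeredityAt k :=
  Iff.rfl

/-- The induction over `m` is heredity over `m` at every level `k ≥ 1`. [folklore] -/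
theorem episodeInductionGM_iff_forall (m : Margins TowerRates.wide) :
    EpisodeInductionGM m ↔ ∀ k, 1 ≤ k → HeredityAtGM m k :=
  ⟨fun h k hk S hP hR hQ s => h S hP hR hQ k hk s, fun h S hP hR hQ k hk s => h k hk S hP hR hQ s⟩

/-- **K1G(m) ∧ K2G(m) ⇒ the interface is inhabited at unit viscosity**, for EVERY margin
(`Realisation.ofEpisodes` is margin-generic). [cite: Palasek2026ElementaryModel, §4] -/
theorem nonempty_realisation_of_episodesGM {m : Margins TowerRates.wide} (h₁ : EpisodeBaseGM m)
    (h₂ : EpisodeInductionGM m) : Nonempty (Realisation 1 TowerRates.wide) := by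
  obtain ⟨S, hP, hR, hQ, ⟨s₁⟩⟩ := h₁
  exact ⟨Realisation.ofEpisodes S s₁ (fun n s => h₂ S hP hR hQ (n + 1) (by omega) s)⟩

/-- K1G(m) ∧ K2G(m) ⇒ Palasek's Step 2 for the wide-base rates (all viscosities). [cite: Palasek2026ElementaryModel, §4] -/
theorem palasekStep2_of_episodesGM {m : Margins TowerRates.wide} (h₁ : EpisodeBaseGM m)
    (h₂ : EpisodeInductionGM m) : PalasekStep2 TowerRates.wide := by
  obtain ⟨W⟩ := nonempty_realisation_of_episodesGM h₁ h₂
  exact palasekStep2_of_realisation one_pos W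

/-- **CLOSER over a general margin.** K1G(m) → K2G(m) → W14 → Fefferman's (C); W14 = the Literature
named fact `tao2011_forced_unconditionalUniqueness_velocity` (UNPROVED; hypothesis) through
`.schwartzForce`. Conditional on all three; none is asserted. [cite: FeffermanClay2006, (C)] [cite: Tao2011, Cor. 11.4] -/
theorem navierStokesBreakdownR3_of_episodesGM {m : Margins TowerRates.wide} (h₁ : EpisodeBaseGM m)
    (h₂ : EpisodeInductionGM m) (hU : tao2011_forced_unconditionalUniqueness_velocity) :
    Summit.NavierStokesRegularity.NavierStokesRegularity.NavierStokesBreakdownR3 :=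
  navierStokesBreakdownR3_of_step2 TowerRates.wide
    (tao2011_forced_unconditionalUniqueness_velocity.schwartzForce hU)
    (palasekStep2_of_episodesGM h₁ h₂)

/-! ## §2 Transport along margins; the design class as a margin conjunct -/

/-- **Transport of a stage along an implication of margins** at its own schedule, level and velocity:
every other clause of `Stage` does not read the margin. [folklore] -/
def Stage.mapMargin {ν : ℝ} {R : TowerRates} {S : Schedule R} {m m' : Margins R} {k : ℕ}
    (s : Stage ν R S m k) (h : m S k s.u → m' S k s.u) : Stage ν R S m' k where
  u := s.u
  p := s.p
  classical := s.classical
  initial := s.initial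
  energy := s.energy
  floor := s.floor
  ceiling := s.ceiling
  quiet := s.quiet
  margin := h s.margin

/-- The transported stage has the same velocity. [folklore] -/
@[simp] theorem Stage.mapMargin_u {ν : ℝ} {R : TowerRates} {S : Schedule R} {m m' : Margins R} {k : ℕ}
    (s : Stage ν R S m k) (h : m S k s.u → m' S k s.u) : (s.mapMargin h).u = s.u := rfl

/-- The transported stage has the same pressure. [folklore] -/
@[simp] theorem Stage.mapMargin_p {ν : ℝ} {R : TowerRates} {S : Schedule R} {m m' : Margins R} {k : ℕ}
    (s : Stage ν R S m k) (h : m S k s.u → m' S k s.u) : (s.mapMargin h).p = s.p := rfl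

/-- Transport preserves `Extends` (both sides). [folklore] -/
theorem Stage.mapMargin_extends {ν : ℝ} {R : TowerRates} {S : Schedule R} {m m' : Margins R} {k : ℕ}
    {s : Stage ν R S m k} {s' : Stage ν R S m (k + 1)} (hss' : s.Extends s')
    (h : m S k s.u → m' S k s.u) (h' : m S (k + 1) s'.u → m' S (k + 1) s'.u) :
    (s.mapMargin h).Extends (s'.mapMargin h') :=
  hss'

/-- **The design class as a margin conjunct**: `withDesign D m` asks `D` (a predicate on schedule,
level and velocity history — the NAMED design, e.g. a profile family up to symmetries with tolerances
at the readout `τ_k`) on top of `m`. [folklore] -/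
def Margins.withDesign {R : TowerRates} (D m : Margins R) : Margins R := fun S k u => D S k u ∧ m S k u

/-- A stage in the design is a stage (drop the design conjunct). [folklore] -/
def Stage.ofWithDesign {ν : ℝ} {R : TowerRates} {S : Schedule R} {D m : Margins R} {k : ℕ}
    (s : Stage ν R S (Margins.withDesign D m) k) : Stage ν R S m k :=
  s.mapMargin fun h => h.2

/-- … with the same velocity. [folklore] -/
@[simp] theorem Stage.ofWithDesign_u {ν : ℝ} {R : TowerRates} {S : Schedule R} {D m : Margins R} {k : ℕ}
    (s : Stage ν R S (Margins.withDesign D m) k) : s.ofWithDesign.u = s.u := rfl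

/-- A stage in the design satisfies the design. [folklore] -/
theorem Stage.design {ν : ℝ} {R : TowerRates} {S : Schedule R} {D m : Margins R} {k : ℕ}
    (s : Stage ν R S (Margins.withDesign D m) k) : D S k s.u :=
  s.margin.1

/-- A stage satisfying a design is a stage in the design (add the conjunct). [folklore] -/
def Stage.toWithDesign {ν : ℝ} {R : TowerRates} {S : Schedule R} {D m : Margins R} {k : ℕ}
    (s : Stage ν R S m k) (hD : D S k s.u) : Stage ν R S (Margins.withDesign D m) k :=
  s.mapMargin fun h => ⟨hD, h⟩

/-- … with the same velocity. [folklore] -/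
@[simp] theorem Stage.toWithDesign_u {ν : ℝ} {R : TowerRates} {S : Schedule R} {D m : Margins R} {k : ℕ}
    (s : Stage ν R S m k) (hD : D S k s.u) : (s.toWithDesign hD).u = s.u := rfl

/-- **The base in a design implies the base** (drop the design; so a designed base is a witness of
K1G(m) itself, in particular of the item of record at `m = routeG wide`). [folklore] -/
theorem EpisodeBaseGM.of_withDesign {D m : Margins TowerRates.wide}
    (h : EpisodeBaseGM (Margins.withDesign D m)) : EpisodeBaseGM m := by
  obtain ⟨S, hP, hR, hQ, ⟨s⟩⟩ := h
  exact ⟨S, hP, hR, hQ, ⟨s.ofWithDesign⟩⟩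

/-- The base in a design is «some pinned rigid quiet schedule carries a level-1 stage over `m`
satisfying `D`» (unbundled). [folklore] -/
theorem episodeBaseGM_withDesign_iff (D m : Margins TowerRates.wide) :
    EpisodeBaseGM (Margins.withDesign D m) ↔
      ∃ (S : Schedule TowerRates.wide) (s : Stage 1 TowerRates.wide S m 1),
        S.Pins 8 (6 / 5) ∧ S.Rigid ∧ S.Quiet ∧ D S 1 s.u := by
  constructor
  · rintro ⟨S, hP, hR, hQ, ⟨s⟩⟩
    exact ⟨S, s.ofWithDesign, hP, hR, hQ, s.design⟩
  · rintro ⟨S, s, hP, hR, hQ, hD⟩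
    exact ⟨S, hP, hR, hQ, ⟨s.toWithDesign hD⟩⟩

/-- **Heredity in a design, unbundled**: «every stage over `m` at level `k` satisfying `D` extends to a
stage over `m` at level `k + 1` satisfying `D`» — the design is ASSUMED of the stage and OWED of the
extension (closure of the design under one episode). [folklore] -/
theorem heredityAtGM_withDesign_iff (D m : Margins TowerRates.wide) (k : ℕ) :
    HeredityAtGM (Margins.withDesign D m) k ↔
      ∀ S : Schedule TowerRates.wide, S.Pins 8 (6 / 5) → S.Rigid → S.Quiet →
        ∀ s : Stage 1 TowerRates.wide S m k, D S k s.u →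
          ∃ s' : Stage 1 TowerRates.wide S m (k + 1), s.Extends s' ∧ D S (k + 1) s'.u := by
  constructor
  · intro h S hP hR hQ s hD
    obtain ⟨s', hs'⟩ := h S hP hR hQ (s.toWithDesign hD)
    exact ⟨s'.ofWithDesign, hs', s'.design⟩
  · intro h S hP hR hQ s
    obtain ⟨s', hs', hD'⟩ := h S hP hR hQ s.ofWithDesign s.design
    exact ⟨s'.toWithDesign hD', hs'⟩

/-- The induction in a design, unbundled the same way at every level `k ≥ 1`. [folklore] -/
theorem episodeInductionGM_withDesign_iff (D m : Margins TowerRates.wide) :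
    EpisodeInductionGM (Margins.withDesign D m) ↔
      ∀ S : Schedule TowerRates.wide, S.Pins 8 (6 / 5) → S.Rigid → S.Quiet → ∀ k : ℕ, 1 ≤ k →
        ∀ s : Stage 1 TowerRates.wide S m k, D S k s.u →
          ∃ s' : Stage 1 TowerRates.wide S m (k + 1), s.Extends s' ∧ D S (k + 1) s'.u := by
  rw [episodeInductionGM_iff_forall]
  constructor
  · intro h S hP hR hQ k hk s hD
    exact (heredityAtGM_withDesign_iff D m k).1 (h k hk) S hP hR hQ s hD
  · intro h k hk
    exact (heredityAtGM_withDesign_iff D m k).2 fun S hP hR hQ s hD => h S hP hR hQ k hk s hD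

/-- For the TRIVIAL design the induction in the design is the induction (the ∀-form of record is the
design-free extreme). [folklore] -/
theorem episodeInductionGM_withDesign_top_iff (m : Margins TowerRates.wide) :
    EpisodeInductionGM (Margins.withDesign (fun _ _ _ => True) m) ↔ EpisodeInductionGM m := by
  rw [episodeInductionGM_withDesign_iff]
  constructor
  · intro h S hP hR hQ k hk s
    obtain ⟨s', hs', -⟩ := h S hP hR hQ k hk s trivial
    exact ⟨s', hs'⟩
  · intro h S hP hR hQ k hk s _
    obtain ⟨s', hs'⟩ := h S hP hR hQ k hk s
    exact ⟨s', hs', trivial⟩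

/-- For the trivial design the base in the design is the base. [folklore] -/
theorem episodeBaseGM_withDesign_top_iff (m : Margins TowerRates.wide) :
    EpisodeBaseGM (Margins.withDesign (fun _ _ _ => True) m) ↔ EpisodeBaseGM m :=
  ⟨EpisodeBaseGM.of_withDesign, fun ⟨S, hP, hR, hQ, ⟨s⟩⟩ => ⟨S, hP, hR, hQ, ⟨s.toWithDesign trivial⟩⟩⟩

/-- **A designed pair gives (C)** — the honest `∃ D, ∀ stage in D` route, by name: base in the design
+ heredity in the design (+ W14) ⇒ Fefferman's (C), for ANY design `D` over ANY margin `m` (the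
closer of §1 at `withDesign D m`). It does NOT pass through the design-free K2G. Conditional on its
three hypotheses; nothing asserted. [cite: FeffermanClay2006, (C)] [cite: Tao2011, Cor. 11.4] -/
theorem navierStokesBreakdownR3_of_designed {D m : Margins TowerRates.wide}
    (h₁ : EpisodeBaseGM (Margins.withDesign D m)) (h₂ : EpisodeInductionGM (Margins.withDesign D m))
    (hU : tao2011_forced_unconditionalUniqueness_velocity) :
    Summit.NavierStokesRegularity.NavierStokesRegularity.NavierStokesBreakdownR3 :=
  navierStokesBreakdownR3_of_episodesGM h₁ h₂ hU

/-- With the route margin kept as a conjunct, a designed stage is a globally anchored registered stage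
(so every v2.3′ lemma — first readout pinned by the anchor, rigid readouts, the dead re-reading levers
— applies to it through `Stage.ofWithDesign`). [folklore] -/
theorem Stage.routeG_anchorGlobal_of_withDesign {S : Schedule TowerRates.wide}
    {D : Margins TowerRates.wide} {k : ℕ}
    (s : Stage 1 TowerRates.wide S (Margins.withDesign D (Margins.routeG TowerRates.wide)) k) :
    S.AnchorGlobal s.u :=
  s.ofWithDesign.routeG_anchorGlobal

end Summit.NavierStokesRegularity.FluidComputer.PalasekTowerClayBridge

end
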